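import Mathlib
import HarnessLib
import Literature.Computability.AlgebraicComplexity.TensorSemiring
import Literature.Computability.AlgebraicComplexity.TensorRestrictionRank
import Literature.Computability.AlgebraicComplexity.AlmanLi2026SpectrumMatMul
import Summits.MatrixMultiplication.MatrixMultiplication.Theorems.OutsiderSandwichGluingGain
import Summits.MatrixMultiplication.MatrixMultiplication.Theorems.OutsiderSandwichTraceDefect

/-!
# Outsider sandwich — the TRACE PENCIL through `⟨2,2,2⟩` and `C₁` (decomp-mm lens-4, g22, part 2)

Companion of `OutsiderSandwichTraceDefect` (supporting item `stmt-MatrixMultiplication-27147`,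
`BlockOneIsMM`; cut of record UNCHANGED).  Write `A = A₀ + (tr A/2)·I` (`A₀` traceless).  The
one-parameter family of `4 × 4 × 4` tensors

  `T(c) : (A; u, w) ↦ (A·u, (A₀ + c·(tr A/2)·I)·w) = mmPair 2 + (c − 1)·halfTrace`   (`c ∈ ℂ`)

interpolates the two tensors of the leaf: **`T(1) = mmPair 2 ≅ ⟨2,2,2⟩`** and
**`T(−1) = uHalf 2 − adjTwist ≅ C₁`** (`A₀ − (tr A/2)·I = −adj A = −J⁻¹AᵀJ`; `tracePencil_neg_one`,
`coupling₁_restrictsTo_tracePencil_neg_one`, `tracePencil_neg_one_restrictsTo_coupling₁` — the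
adjugate slot IS the transposed slot up to an invertible signed relabelling).  Every member differs
from BOTH by a multiple of the trace helper, so the whole pencil lies in the one-letter band of
part 1: for every `c` and every universal point,
**`|F(T c) − F⟨2,2,2⟩| ≤ F⟨1,2,1⟩`** and **`|F(T c) − F(C₁)| ≤ F⟨1,2,1⟩`**
(`abs_map_tracePencil_sub_map_matMul_le`, `abs_map_tracePencil_sub_map_coupling₁_le`).

**Inversion symmetry** (§3b): `T(c) ≥ T(1/c) ≥ T(c)` for `c ≠ 0` (substitute
`A' = Φ_c(A) = A₀ + c·(tr A/2)·I` on the `x`-leg and swap the two slots; `Φ_{1/c}Φ_c = id`) —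
`tracePencil_restrictsTo_inv`, `tracePencil_inv_restrictsTo`, `map_tracePencil_inv`; so `⟨2,2,2⟩`
and `C₁` are exactly the two inversion-FIXED members `c = ±1` of the pencil.
Memo-level (NODE-g22, not formalised): the determinant quartic of the `x`-slice space of `T(c)` is
`det A·(det A + (c²−1)(tr A)²/4)`, whose pencil invariant is `{c², c⁻²}` — the family is NOT
isotrivial, so no degeneration `T(c_gen) ⊵ ⟨2,2,2⟩` comes for free; `T(−c)` is the first-slot
transpose twist of `T(c)`.

[ChristandlVranaZuiddam2023, §1.1–1.2]; [AlmanLi2026, Prop. 4.1]; [Blaser2013, Def. 7.2];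
[CoppersmithWinograd1990, §7].
-/

noncomputable section

open Literature.Computability.AlgebraicComplexity
open Summit.MatrixMultiplication.MatrixMultiplication.Theorems.OutsiderSandwichCoupling (coupling₁)
open Summit.MatrixMultiplication.MatrixMultiplication.Theorems.OutsiderSandwichBlockNormalForm
  (pairTensor coupling₁_restrictsTo_pairTensor pairTensor_restrictsTo_coupling₁)
open Summit.MatrixMultiplication.MatrixMultiplication.Theorems.OutsiderSandwichExchangeSpectral
  (map_matMul_eq_rpow)
open Summit.MatrixMultiplication.MatrixMultiplication.Theorems.OutsiderSandwichGluingGain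
  (uHalf wHalf directSumTensor_restrictsTo_add')
open Summit.MatrixMultiplication.MatrixMultiplication.Theorems.OutsiderSandwichTraceDefect

namespace Summit.MatrixMultiplication.MatrixMultiplication.Theorems.OutsiderSandwichTracePencil

/-! ## 0. Two small restriction tools -/

section Tools

variable {K : Type} [CommSemiring K] {ι κ μ : Type} [Fintype ι] [Fintype κ] [Fintype μ]
  [DecidableEq ι] [DecidableEq κ] [DecidableEq μ]

/-- **A scalar multiple is a restriction**: `t ≥ r • t` (scale one leg). [cite: Blaser2013, Def. 7.2] -/
theorem tensorRestrictsTo_smul (t : ι → κ → μ → K) (r : K) : TensorRestrictsTo t (r • t) := by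
  have e : r • t = fun a b c => (fun _ => r) a * (fun _ => (1 : K)) b * (fun _ => (1 : K)) c *
      t (id a) (id b) (id c) := by
    funext a b c; simp [Pi.smul_apply, smul_eq_mul]
  rw [e]
  exact tensorRestrictsTo_precomp_mul₃ _ _ _ _ _ _ _

/-- **`s + r • d ≤ s ⊕ d`**: a sum with a rescaled second summand is a restriction of the direct sum.
[cite: Blaser2013, Def. 7.2] -/
theorem directSum_restrictsTo_add_smul (s d : ι → κ → μ → K) (r : K) : TensorRestrictsTo (directSumTensor s d) (s + r • d) :=
  ((TensorRestrictsTo.refl s).directSum (tensorRestrictsTo_smul d r)).trans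
    (directSumTensor_restrictsTo_add' _ _)

end Tools

/-! ## 1. The pencil -/

/-- Half the trace helper: `(A; w) ↦ (tr A/2)·w` (`y`-block `1` → `z`-block `0`). [cite: Blaser2013, Def. 7.2] -/
def halfTrace : Fin 2 × Fin 2 → Fin 2 × Fin 2 → Fin 2 × Fin 2 → ℂ := (1 / 2 : ℂ) • traceHelper

/-- **The trace pencil `T(c) : (A; u, w) ↦ (A·u, (A₀ + c·(tr A/2)·I)·w)`**, `A₀ = A − (tr A/2)I`:
`T(c) = mmPair 2 + (c − 1)·halfTrace`. [cite: CoppersmithWinograd1990, §7] -/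
def tracePencil (c : ℂ) : Fin 2 × Fin 2 → Fin 2 × Fin 2 → Fin 2 × Fin 2 → ℂ :=
  mmPair 2 + (c - 1) • halfTrace

/-- `T(c) = mmPair 2 + ((c − 1)/2) • traceHelper`. [folklore] -/
theorem tracePencil_eq (c : ℂ) : tracePencil c = mmPair 2 + ((c - 1) / 2) • traceHelper := by
  rw [tracePencil, halfTrace, smul_smul]
  congr 2
  ring

/-- **`T(1) = mmPair 2`** (`≅ ⟨2,2,2⟩`). [folklore] -/
theorem tracePencil_one : tracePencil 1 = mmPair 2 := by
  simp [tracePencil]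

/-- **`T(−1) = uHalf 2 − adjTwist`**: `(A; u, w) ↦ (Au, −adj(A)·w)` (`A − (tr A)·I = −adj A`).
[cite: CoppersmithWinograd1990, §7] -/
theorem tracePencil_neg_one : tracePencil (-1) = uHalf 2 - adjTwist := by
  rw [tracePencil_eq, mmPair_two_eq]
  funext a y z
  simp only [Pi.add_apply, Pi.sub_apply, Pi.smul_apply, smul_eq_mul]
  ring

/-- `T(c) = T(−1) + ((c + 1)/2) • traceHelper` — every member is `C₁`'s representative plus a multiple
of the trace helper. [folklore] -/
theorem tracePencil_eq_neg_one_add (c : ℂ) :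
    tracePencil c = (uHalf 2 - adjTwist) + ((c + 1) / 2) • traceHelper := by
  rw [← tracePencil_neg_one, tracePencil_eq, tracePencil_eq]
  funext a y z
  simp only [Pi.add_apply, Pi.smul_apply, smul_eq_mul]
  ring

/-! ## 2. The two special members are `⟨2,2,2⟩` and `C₁` (restriction-equivalence) -/

/-- **`uHalf 2 − adjTwist ≥ pairTensor 2`**: the signed relabelling of part 1 is an involution up to
the sign `(−1)·(−1) = 1`, so it can be undone. [cite: Blaser2013, Def. 7.2] -/
theorem uHalf_sub_adjTwist_restrictsTo_pairTensor :
    TensorRestrictsTo (uHalf 2 - adjTwist) (pairTensor 2) := by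
  have e : pairTensor 2 =
      fun a y z => (1 : ℂ) * weightY y * weightZ z * (uHalf 2 - adjTwist) a (twistY y) (twistZ z) := by
    funext a y z
    obtain ⟨a₁, a₂⟩ := a
    obtain ⟨y₁, y₂⟩ := y
    obtain ⟨z₁, z₂⟩ := z
    simp only [uHalf, adjTwist, pairTensor, weightY, weightZ, twistY, twistZ, sgn,
      OutsiderSandwichTraceDefect.flip, Pi.sub_apply]
    fin_cases a₁ <;> fin_cases a₂ <;> fin_cases y₁ <;> fin_cases y₂ <;> fin_cases z₁ <;>
      fin_cases z₂ <;> simp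
  rw [e]
  exact tensorRestrictsTo_precomp_mul₃ _ _ _ _ _ _ _

/-- **`C₁ ≥ T(−1)`**. [cite: ChristandlVranaZuiddam2023, §1.1] -/
theorem coupling₁_restrictsTo_tracePencil_neg_one : TensorRestrictsTo coupling₁ (tracePencil (-1)) := by
  rw [tracePencil_neg_one]
  exact coupling₁_restrictsTo_pairTensor.trans pairTensor_restrictsTo_uHalf_sub_adjTwist

/-- **`T(−1) ≥ C₁`**. [cite: ChristandlVranaZuiddam2023, §1.1] -/
theorem tracePencil_neg_one_restrictsTo_coupling₁ : TensorRestrictsTo (tracePencil (-1)) coupling₁ := by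
  rw [tracePencil_neg_one]
  exact uHalf_sub_adjTwist_restrictsTo_pairTensor.trans pairTensor_restrictsTo_coupling₁

/-- **`⟨2,2,2⟩ ≥ T(1)`**. [cite: Blaser2013, Lemma 5.4] -/
theorem matMul_restrictsTo_tracePencil_one :
    TensorRestrictsTo (matMulTensor ℂ 2 2 2) (tracePencil 1) := by
  rw [tracePencil_one]; exact matMul_restrictsTo_mmPair_two

/-- **`T(1) ≥ ⟨2,2,2⟩`**. [cite: Blaser2013, Lemma 5.4] -/
theorem tracePencil_one_restrictsTo_matMul :
    TensorRestrictsTo (tracePencil 1) (matMulTensor ℂ 2 2 2) := by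
  rw [tracePencil_one]; exact mmPair_two_restrictsTo_matMul

/-! ## 3. The whole pencil lies in the one-letter band -/

/-- **`⟨2,2,2⟩ ⊕ ⟨1,2,1⟩ ≥ T(c)`** for every `c`. [cite: ChristandlVranaZuiddam2023, §1.1] -/
theorem directSum_matMul_restrictsTo_tracePencil (c : ℂ) :
    TensorRestrictsTo (directSumTensor (matMulTensor ℂ 2 2 2) (matMulTensor ℂ 1 2 1)) (tracePencil c) := by
  rw [tracePencil_eq]
  exact (matMul_restrictsTo_mmPair_two.directSum matMul121_restrictsTo_traceHelper).trans
    (directSum_restrictsTo_add_smul _ _ _)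

/-- **`T(c) ⊕ ⟨1,2,1⟩ ≥ ⟨2,2,2⟩`** for every `c` (`mmPair 2 = T(c) − ((c−1)/2)·traceHelper`).
[cite: ChristandlVranaZuiddam2023, §1.1] -/
theorem directSum_tracePencil_restrictsTo_matMul (c : ℂ) :
    TensorRestrictsTo (directSumTensor (tracePencil c) (matMulTensor ℂ 1 2 1)) (matMulTensor ℂ 2 2 2) := by
  have e : mmPair 2 = tracePencil c + (-((c - 1) / 2)) • traceHelper := by
    rw [tracePencil_eq, add_assoc, ← add_smul, add_neg_cancel, zero_smul, add_zero]
  have h : TensorRestrictsTo (directSumTensor (tracePencil c) (matMulTensor ℂ 1 2 1)) (mmPair 2) := by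
    rw [e]
    exact ((TensorRestrictsTo.refl _).directSum matMul121_restrictsTo_traceHelper).trans
      (directSum_restrictsTo_add_smul _ _ _)
  exact h.trans mmPair_two_restrictsTo_matMul

/-- **`C₁ ⊕ ⟨1,2,1⟩ ≥ T(c)`** for every `c`. [cite: ChristandlVranaZuiddam2023, §1.1] -/
theorem directSum_coupling₁_restrictsTo_tracePencil (c : ℂ) :
    TensorRestrictsTo (directSumTensor coupling₁ (matMulTensor ℂ 1 2 1)) (tracePencil c) := by
  rw [tracePencil_eq_neg_one_add, ← tracePencil_neg_one]
  exact (coupling₁_restrictsTo_tracePencil_neg_one.directSum matMul121_restrictsTo_traceHelper).trans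
    (directSum_restrictsTo_add_smul _ _ _)

/-- **`T(c) ⊕ ⟨1,2,1⟩ ≥ C₁`** for every `c`. [cite: ChristandlVranaZuiddam2023, §1.1] -/
theorem directSum_tracePencil_restrictsTo_coupling₁ (c : ℂ) :
    TensorRestrictsTo (directSumTensor (tracePencil c) (matMulTensor ℂ 1 2 1)) coupling₁ := by
  have e : tracePencil (-1) = tracePencil c + (-((c + 1) / 2)) • traceHelper := by
    rw [tracePencil_eq_neg_one_add c, tracePencil_neg_one, add_assoc, ← add_smul, add_neg_cancel,
      zero_smul, add_zero]
  have h : TensorRestrictsTo (directSumTensor (tracePencil c) (matMulTensor ℂ 1 2 1))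
      (tracePencil (-1)) := by
    rw [e]
    exact ((TensorRestrictsTo.refl _).directSum matMul121_restrictsTo_traceHelper).trans
      (directSum_restrictsTo_add_smul _ _ _)
  exact h.trans tracePencil_neg_one_restrictsTo_coupling₁

/-! ## 3b. The inversion symmetry `T(c) ≅ T(1/c)`: `⟨2,2,2⟩` and `C₁` are the fixed points -/

/-- Matrix of the trace rescaling `Φ_c : A ↦ A₀ + c·(tr A/2)·I` on `Mat₂`: `phiCoeff c a' a` is the
coefficient of `A_a` in `Φ_c(A)_{a'}` (off-diagonal entries fixed; `Φ_c(A)_{ii} = (c+1)/2·A_{ii} +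
(c−1)/2·A_{jj}`, `j ≠ i`).  `Φ_c Φ_{c'} = Φ_{cc'}`, `Φ_1 = id`. [folklore] -/
def phiCoeff (c : ℂ) (a' a : Fin 2 × Fin 2) : ℂ :=
  if a'.1 ≠ a'.2 then (if a = a' then 1 else 0)
  else if a.1 = a.2 then (if a = a' then (c + 1) / 2 else (c - 1) / 2) else 0

/-- The block swap `(b, i) ↦ (σ b, i)` exchanging the `u`- and `w`-slots. [folklore] -/
def swapBlk (y : Fin 2 × Fin 2) : Fin 2 × Fin 2 := (OutsiderSandwichTraceDefect.flip y.1, y.2)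

/-- **The pencil identity `T(c)(A; u, w) = swap ∘ T(1/c)(Φ_c A; w, u)`** (`c ≠ 0`), entrywise:
`T_c(a, y, z) = Σ_{a'} [Φ_c]_{a' a} · T_{1/c}(a', swap y, swap z)` (uses `Φ_{1/c} ∘ Φ_c = id`).
[cite: CoppersmithWinograd1990, §7] -/
theorem tracePencil_eq_sum_phiCoeff {c : ℂ} (hc : c ≠ 0) (a y z : Fin 2 × Fin 2) :
    tracePencil c a y z = ∑ a', phiCoeff c a' a * tracePencil c⁻¹ a' (swapBlk y) (swapBlk z) := by
  obtain ⟨a₁, a₂⟩ := a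
  obtain ⟨y₁, y₂⟩ := y
  obtain ⟨z₁, z₂⟩ := z
  simp only [tracePencil_eq, Fintype.sum_prod_type, Fin.sum_univ_two, Pi.add_apply, Pi.smul_apply,
    smul_eq_mul, mmPair, uHalf, wPlain, traceHelper, phiCoeff, swapBlk, OutsiderSandwichTraceDefect.flip]
  fin_cases a₁ <;> fin_cases a₂ <;> fin_cases y₁ <;> fin_cases y₂ <;> fin_cases z₁ <;>
    fin_cases z₂ <;> simp <;> field_simp <;> ring

/-- **`T(1/c) ≥ T(c)`** for `c ≠ 0` (`x`-leg: the matrix of `Φ_c`; `y`, `z`: the block swap).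
[cite: Blaser2013, Def. 7.2] -/
theorem tracePencil_inv_restrictsTo {c : ℂ} (hc : c ≠ 0) :
    TensorRestrictsTo (tracePencil c⁻¹) (tracePencil c) := by
  refine ⟨fun a a' => phiCoeff c a' a, fun y y' => if y' = swapBlk y then 1 else 0,
    fun z z' => if z' = swapBlk z then 1 else 0, fun a y z => ?_⟩
  rw [tracePencil_eq_sum_phiCoeff hc]
  refine Finset.sum_congr rfl fun a' _ => ?_
  rw [Finset.sum_eq_single (swapBlk y) (fun x _ hx => by simp [hx]) (by simp),
    Finset.sum_eq_single (swapBlk z) (fun x _ hx => by simp [hx]) (by simp)]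
  simp

/-- **`T(c) ≥ T(1/c)`** for `c ≠ 0`: the pencil is symmetric under `c ↦ 1/c`; its two fixed points
`c = 1`, `c = −1` are `⟨2,2,2⟩` and `C₁`. [cite: Blaser2013, Def. 7.2] -/
theorem tracePencil_restrictsTo_inv {c : ℂ} (hc : c ≠ 0) :
    TensorRestrictsTo (tracePencil c) (tracePencil c⁻¹) := by
  have h := tracePencil_inv_restrictsTo (inv_ne_zero hc)
  rwa [inv_inv] at h

/-- At universal points the pencil is inversion-invariant: **`F(T c) = F(T c⁻¹)`** (`c ≠ 0`).
[cite: ChristandlVranaZuiddam2023, §1.2] -/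
theorem map_tracePencil_inv {F : SpectralMap ℂ} (hF : IsUniversalSpectralPoint ℂ F) {c : ℂ}
    (hc : c ≠ 0) : F (tracePencil c⁻¹) = F (tracePencil c) :=
  le_antisymm (hF.mono _ _ (tracePencil_restrictsTo_inv hc)) (hF.mono _ _ (tracePencil_inv_restrictsTo hc))

/-! ## 4. At universal points: the pencil is within one letter of both ends -/

variable {F : SpectralMap ℂ}

/-- **`|F(T c) − F⟨2,2,2⟩| ≤ F⟨1,2,1⟩ = 2^{θ₁}`** for every `c` and every universal point.
[cite: ChristandlVranaZuiddam2023, §1.2] -/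
theorem abs_map_tracePencil_sub_map_matMul_le (hF : IsUniversalSpectralPoint ℂ F) (c : ℂ) :
    |F (tracePencil c) - F (matMulTensor ℂ 2 2 2)| ≤ F (matMulTensor ℂ 1 2 1) := by
  have h₁ := hF.mono _ _ (directSum_matMul_restrictsTo_tracePencil c)
  have h₂ := hF.mono _ _ (directSum_tracePencil_restrictsTo_matMul c)
  rw [hF.map_directSum] at h₁ h₂
  rw [abs_sub_le_iff]; constructor <;> linarith

/-- **`|F(T c) − F(C₁)| ≤ F⟨1,2,1⟩ = 2^{θ₁}`** for every `c` and every universal point.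
[cite: ChristandlVranaZuiddam2023, §1.2] -/
theorem abs_map_tracePencil_sub_map_coupling₁_le (hF : IsUniversalSpectralPoint ℂ F) (c : ℂ) :
    |F (tracePencil c) - F coupling₁| ≤ F (matMulTensor ℂ 1 2 1) := by
  have h₁ := hF.mono _ _ (directSum_coupling₁_restrictsTo_tracePencil c)
  have h₂ := hF.mono _ _ (directSum_tracePencil_restrictsTo_coupling₁ c)
  rw [hF.map_directSum] at h₁ h₂
  rw [abs_sub_le_iff]; constructor <;> linarith

/-- In letters: **`2^{τ} − 2^{θ₁} ≤ F(T c) ≤ 2^{τ} + 2^{θ₁}`** for every member of the pencil.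
[cite: AlmanLi2026, Prop. 4.1] -/
theorem map_tracePencil_mem_Icc (hF : IsUniversalSpectralPoint ℂ F) (c : ℂ) :
    F (tracePencil c) ∈ Set.Icc ((2 : ℝ) ^ ∑ i, specMMPoint ℂ F i - (2 : ℝ) ^ specMMPoint ℂ F 1)
      ((2 : ℝ) ^ ∑ i, specMMPoint ℂ F i + (2 : ℝ) ^ specMMPoint ℂ F 1) := by
  have h := abs_map_tracePencil_sub_map_matMul_le hF c
  rw [map_matMul_eq_rpow hF, map_matMul121_eq_rpow hF, abs_sub_le_iff] at h
  constructor <;> linarith [h.1, h.2]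

end Summit.MatrixMultiplication.MatrixMultiplication.Theorems.OutsiderSandwichTracePencil
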